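import Literature.Probability.Percolation.SepArmsGlue
import HarnessLib

/-!
# Well-separated `k`-arm events with PRESCRIBED landing sides, and their deterministic gluing

Topic: Probability / Percolation; family `crit-perc` (critical site percolation on the triangular
lattice `𝕋`; hexagonal annuli `Λ_N ∖ Λ_n`, `Λ_n = triBall n`; the order-free arm events
`armEvent κ n N` of `ArmEvents.lean`). Generalisation of `SepArmsGlue.lean` (where arm `j` lands on
side `j`) to an arbitrary injective assignment `s : Fin k → Fin 6` of landing sides — Nolin's
"uniformly in all landing sequences `I/I'`" (EJP 13 (2008), Thm. 11 [arXiv 0711.4948: Thm. 10]) in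
the tree's format of one side per arm — serving the named fact
`Literature.Probability.Percolation.Nolin2008_prop17_quasiMult` (Nolin, Prop. 17 [arXiv Prop. 16]).
The point of the generalisation is that the tree's ONE proved instance of the arm-separation
theorem, `Nolin2008_twoArm_separation_holds` (`j = 2`, `σ = BW`, open arm on side `0`, closed arm
on side `3`), becomes literally an instance of the separation hypothesis of the generic pipeline
(`sepTwoArm_subset_sepArmsOn`, `Nolin2008_twoArm_quasiMult_via_sepArmsOn`, `SepArmsOnQuasiMult.lean`).

* `sepArmsOn κ s n N` — carriers `X j` with `ω ∈ sepArmAt (s j) (κ j) (X j) n N` for every `j`,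
  carriers of two arms of the same colour disjoint; `sepArms κ = sepArmsOn κ (Fin.castLE hk)`
  (`sepArms_eq_sepArmsOn`, by `rfl`); one-colour halves `sepArmsOnCol`, `sepArmsOn_eq_inter`,
  monotonicity, locality `determinedBy_sepArmsOnCol`;
* `sepArmsOnGlueCol`, `sepArmsOnGlueExtCol` — the gluing / extension events `fourGlue q`,
  `fourGlueExt q` read in colour `b` in the frames `s j` of the arms of colour `b`;
* `sepArmsOn_glue_subset`, `sepArmsOn_glueExt_subset` — **gluing and extension** (Nolin, Prop. 12
  [arXiv Prop. 11]) for injective `s`, verbatim the proofs of `SepArmsGlue.lean`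
  (`sepArmAt_glue_path`, `glueZone_disjoint`, `mem_armEvent_of_disjointPaths`).

Everything here is PROVED; no named fact is introduced.

## References

* P. Nolin, *Near-critical percolation in two dimensions*, Electron. J. Probab. 13 (2008),
  1562–1623, §4.2 (Def. 6–8 of arXiv 0711.4948), §4.3 Thm. 11, Prop. 12 [arXiv Thm. 10, Prop. 11].
  [Nolin2008]
* H. Kesten, *Scaling relations for 2D-percolation*, Comm. Math. Phys. 109 (1987). [Kesten1987]

Tree: `sepArmAt`, `isUpperSet_sepArmAt_true`, `isLowerSet_sepArmAt_false`, `determinedBy_sepArmAt`,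
`fourGlue`, `fourGlueExt`, `readFrame`, `glueZone`, `glueZone_disjoint`, `disjoint_inter_colour`,
`sepArmAt_glue_path`, `sepArmAt_glueExt_path`, `mem_armEvent_of_disjointPaths`
(`ArmSeparationFourArm.lean`); `sepArms` (`SepArmsGlue.lean`); `DeterminedBy.iUnion`,
`DeterminedBy.iInter` (`SiteMonotonicity.lean`).
-/

noncomputable section

open MeasureTheory Set

namespace Literature.Probability.Percolation

open LatticeModels

variable {k : ℕ}

/-! ### The events -/

/-- **The well-separated `k`-arm event with colours `κ` and landing sides `s`** (Nolin 2008, §4.2, the event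
`Ã̃^{η,I/η',I'}_{k,κ}(n, N)` with `η = η' = 1/64` and the landing sequence "middle halves of side `j`
of `∂Λ_n` and of `∂Λ_N` for the `j`-th arm", relaxed arm by arm as in `sepOpenArm`): a family of
carriers `X j` such that `ω` has a fenced arm of colour `κ j` landing on side `j` confined to `X j`
(`sepArmAt j (κ j) (X j) n N`), carriers of arms of the same colour being pairwise disjoint. [cite: Nolin2008, §4.2, well-separated arm events with landing areas (arXiv 0711.4948: Def. 6–8)] -/
def sepArmsOn (κ : Fin k → Bool) (s : Fin k → Fin 6) (n N : ℕ) : Set (SiteConfig (Site 2)) :=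
  {ω | ∃ X : Fin k → Set (Site 2), (∀ i j, i ≠ j → κ i = κ j → Disjoint (X i) (X j)) ∧
    ∀ j : Fin k, ω ∈ sepArmAt (s j).val (κ j) (X j) n N}

/-- **The arms of colour `b` of `sepArmsOn κ s n N`**: carriers for the indices `j` with `κ j = b` only. [cite: Nolin2008, §4.2, well-separated arm events with landing areas (arXiv 0711.4948: Def. 6–8)] -/
def sepArmsOnCol (κ : Fin k → Bool) (s : Fin k → Fin 6) (b : Bool) (n N : ℕ) : Set (SiteConfig (Site 2)) :=
  {ω | ∃ X : Fin k → Set (Site 2), (∀ i j, i ≠ j → κ i = b → κ j = b → Disjoint (X i) (X j)) ∧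
    ∀ j : Fin k, κ j = b → ω ∈ sepArmAt (s j).val b (X j) n N}

/-- `sepArmsOn κ s` is contained in each of its one-colour halves. [folklore] -/
theorem sepArmsOn_subset_sepArmsOnCol (κ : Fin k → Bool) (s : Fin k → Fin 6) (b : Bool) (n N : ℕ) :
    sepArmsOn κ s n N ⊆ sepArmsOnCol κ s b n N := by
  rintro ω ⟨X, hX, hA⟩
  refine ⟨X, fun i j hij hi hj => hX i j hij (hi.trans hj.symm), fun j hj => ?_⟩
  have h := hA j
  rwa [hj] at h

/-- The two one-colour halves together give `sepArmsOn κ s` (merge the carriers by colour). [folklore] -/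
theorem sepArmsOnCol_inter_subset (κ : Fin k → Bool) (s : Fin k → Fin 6) (n N : ℕ) :
    sepArmsOnCol κ s true n N ∩ sepArmsOnCol κ s false n N ⊆ sepArmsOn κ s n N := by
  classical
  rintro ω ⟨⟨X, hX, hA⟩, ⟨Y, hY, hB⟩⟩
  refine ⟨fun j => if κ j = true then X j else Y j, fun i j hij hκ => ?_, fun j => ?_⟩
  · dsimp only
    by_cases hi : κ i = true
    · have hj : κ j = true := hκ ▸ hi
      rw [if_pos hi, if_pos hj]
      exact hX i j hij hi hj
    · have hi' : κ i = false := by simpa using hi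
      have hj' : κ j = false := hκ ▸ hi'
      have hj : ¬ κ j = true := by rw [hj']; decide
      rw [if_neg hi, if_neg hj]
      exact hY i j hij hi' hj'
  · dsimp only
    by_cases hj : κ j = true
    · rw [if_pos hj, hj]
      exact hA j hj
    · have hj' : κ j = false := by simpa using hj
      rw [if_neg hj, hj']
      exact hB j hj'

/-- `sepArmsOn κ s = (open half) ∩ (closed half)`. [folklore] -/
theorem sepArmsOn_eq_inter (κ : Fin k → Bool) (s : Fin k → Fin 6) (n N : ℕ) :
    sepArmsOn κ s n N = sepArmsOnCol κ s true n N ∩ sepArmsOnCol κ s false n N :=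
  Subset.antisymm (fun _ h => ⟨sepArmsOn_subset_sepArmsOnCol κ s true n N h, sepArmsOn_subset_sepArmsOnCol κ s false n N h⟩)
    (sepArmsOnCol_inter_subset κ s n N)

/-- The open half is increasing. [folklore] -/
theorem isUpperSet_sepArmsOnCol_true (κ : Fin k → Bool) (s : Fin k → Fin 6) (n N : ℕ) : IsUpperSet (sepArmsOnCol κ s true n N) := by
  rintro ω ω' hle ⟨X, hX, hA⟩
  exact ⟨X, hX, fun j hj => isUpperSet_sepArmAt_true _ _ _ _ hle (hA j hj)⟩

/-- The closed half is decreasing. [folklore] -/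
theorem isLowerSet_sepArmsOnCol_false (κ : Fin k → Bool) (s : Fin k → Fin 6) (n N : ℕ) : IsLowerSet (sepArmsOnCol κ s false n N) := by
  rintro ω ω' hle ⟨X, hX, hA⟩
  exact ⟨X, hX, fun j hj => isLowerSet_sepArmAt_false _ _ _ _ hle (hA j hj)⟩

/-- **Locality of the one-colour halves**: `sepArmsOnCol κ s b n N` is determined by any set of sites
containing the rotated cone supports `ρ^j(sepConeSupport n N)` of the sides `j` of colour `b`
(`4 ≤ n ≤ N`). [folklore] -/
theorem determinedBy_sepArmsOnCol (κ : Fin k → Bool) (s : Fin k → Fin 6) (b : Bool) {n N : ℕ} (h4 : 4 ≤ n) (hnN : n ≤ N)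
    {F : Set (Site 2)} (hF : ∀ j : Fin k, κ j = b → triRotIsoPow (s j).val '' sepConeSupport n N ⊆ F) :
    DeterminedBy (sepArmsOnCol κ s b n N) F := by
  have h : sepArmsOnCol κ s b n N = ⋃ X : Fin k → Set (Site 2),
      ⋃ (_ : ∀ i j, i ≠ j → κ i = b → κ j = b → Disjoint (X i) (X j)),
        ⋂ j : Fin k, ⋂ (_ : κ j = b), sepArmAt (s j).val b (X j) n N := by
    ext ω
    simp only [sepArmsOnCol, mem_setOf_eq, mem_iUnion, mem_iInter, exists_prop]
  rw [h]
  exact DeterminedBy.iUnion fun X => DeterminedBy.iUnion fun _ =>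
    DeterminedBy.iInter fun j => DeterminedBy.iInter fun hj => (determinedBy_sepArmAt _ b (X j) h4 hnN).mono (hF j hj)

/-- **The gluing events of the arms of colour `b`**: the one-cone gluing event `fourGlue q` of
`ArmSeparationFourArm.lean` read in colour `b` in the frame of every side `j` with `κ j = b`. [cite: Nolin2008, §4.3 Prop. 12 (proof) (arXiv 0711.4948: Prop. 11)] -/
def sepArmsOnGlueCol (κ : Fin k → Bool) (s : Fin k → Fin 6) (b : Bool) (q : ℕ) : Set (SiteConfig (Site 2)) :=
  ⋂ j : Fin k, ⋂ (_ : κ j = b), readFrame (s j).val b ⁻¹' fourGlue q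

/-- **The extension events of the arms of colour `b`** (`fourGlueExt q` in the frames of colour `b`). [cite: Nolin2008, §4.3 Prop. 12 (proof) (arXiv 0711.4948: Prop. 11)] -/
def sepArmsOnGlueExtCol (κ : Fin k → Bool) (s : Fin k → Fin 6) (b : Bool) (q : ℕ) : Set (SiteConfig (Site 2)) :=
  ⋂ j : Fin k, ⋂ (_ : κ j = b), readFrame (s j).val b ⁻¹' fourGlueExt q

/-- Membership in `sepArmsOnGlueCol`, unfolded. [folklore] -/
theorem mem_sepArmsOnGlueCol {κ : Fin k → Bool} {s : Fin k → Fin 6} {b : Bool} {q : ℕ} {ω : SiteConfig (Site 2)} :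
    ω ∈ sepArmsOnGlueCol κ s b q ↔ ∀ j : Fin k, κ j = b → readFrame (s j).val b ω ∈ fourGlue q := by
  simp only [sepArmsOnGlueCol, mem_iInter, mem_preimage]

/-- Membership in `sepArmsOnGlueExtCol`, unfolded. [folklore] -/
theorem mem_sepArmsOnGlueExtCol {κ : Fin k → Bool} {s : Fin k → Fin 6} {b : Bool} {q : ℕ} {ω : SiteConfig (Site 2)} :
    ω ∈ sepArmsOnGlueExtCol κ s b q ↔ ∀ j : Fin k, κ j = b → readFrame (s j).val b ω ∈ fourGlueExt q := by
  simp only [sepArmsOnGlueExtCol, mem_iInter, mem_preimage]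

/-- On both one-colour gluing events, every arm's frame carries the gluing event in its colour. [folklore] -/
theorem readFrame_mem_fourGlue_of_mem_on {κ : Fin k → Bool} {s : Fin k → Fin 6} {q : ℕ} {ω : SiteConfig (Site 2)}
    (hT : ω ∈ sepArmsOnGlueCol κ s true q) (hF : ω ∈ sepArmsOnGlueCol κ s false q) (j : Fin k) :
    readFrame (s j).val (κ j) ω ∈ fourGlue q := by
  rw [mem_sepArmsOnGlueCol] at hT hF
  cases hj : κ j
  · exact hF j hj
  · exact hT j hj

/-- The same for the extension events. [folklore] -/
theorem readFrame_mem_fourGlueExt_of_mem_on {κ : Fin k → Bool} {s : Fin k → Fin 6} {q : ℕ} {ω : SiteConfig (Site 2)}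
    (hT : ω ∈ sepArmsOnGlueExtCol κ s true q) (hF : ω ∈ sepArmsOnGlueExtCol κ s false q) (j : Fin k) :
    readFrame (s j).val (κ j) ω ∈ fourGlueExt q := by
  rw [mem_sepArmsOnGlueExtCol] at hT hF
  cases hj : κ j
  · exact hF j hj
  · exact hT j hj

/-! ### Deterministic gluing and extension -/

/-- **Zones of different arms are disjoint**: for `i ≠ j` (sides `< 6`), the glued zones
intersected with the respective colour classes are disjoint — by `glueZone_disjoint` for two arms of
the same colour (whose carriers are disjoint), by the colours otherwise. [cite: Nolin2008, §4.3 Prop. 12 (proof) (arXiv 0711.4948: Prop. 11)] -/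
theorem glueZone_colour_disjoint_on (κ : Fin k → Bool) (s : Fin k → Fin 6) (hs : Function.Injective s) {q n₁ n₃ : ℕ} (hq : 1 ≤ q)
    {X Y : Fin k → Set (Site 2)} (hX : ∀ i j, i ≠ j → κ i = κ j → Disjoint (X i) (X j))
    (hY : ∀ i j, i ≠ j → κ i = κ j → Disjoint (Y i) (Y j)) (ω : SiteConfig (Site 2)) {i j : Fin k} (hij : i ≠ j) :
    Disjoint (glueZone q n₁ n₃ (s i).val (X i) (Y i) ∩ {v | v ∈ ω ↔ κ i}) (glueZone q n₁ n₃ (s j).val (X j) (Y j) ∩ {v | v ∈ ω ↔ κ j}) := by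
  by_cases hκ : κ i = κ j
  · have hij' : (s i).val ≠ (s j).val := fun h => hij (hs (Fin.ext h))
    exact Disjoint.mono inter_subset_left inter_subset_left
      (glueZone_disjoint hq (s i).2 (s j).2 hij' (hX i j hij hκ) (hY i j hij hκ))
  · exact disjoint_inter_colour hκ

/-- **Gluing `k ≤ 6` well-separated arms of any colours** (Nolin 2008, proof of Prop. 12 (ii)
[arXiv 0711.4948: Prop. 11], at the scales `64q ≤ 512(q+1)`; Kesten 1987): well-separated `k`-arm
events across `Λ_{64q} ∖ Λ_{n₁}` and across `Λ_{n₃} ∖ Λ_{512(q+1)}` together with the gluing events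
in the `k` frames contain `armEvent κ n₁ n₃`: each arm is glued in its own frame
(`sepArmAt_glue_path`) and the glued arms live in pairwise disjoint zones
(`glueZone_colour_disjoint_on`), hence are disjoint arms (`mem_armEvent_of_disjointPaths`). [cite: Nolin2008, §4.3 Prop. 12 (arXiv 0711.4948: Prop. 11)] -/
theorem sepArmsOn_glue_subset (κ : Fin k → Bool) (s : Fin k → Fin 6) (hs : Function.Injective s) {q n₁ n₃ : ℕ} (hq : 1 ≤ q) (h4 : 4 ≤ n₁)
    (h₁ : n₁ ≤ 64 * q) (h₃ : 512 * (q + 1) ≤ n₃) :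
    sepArmsOn κ s n₁ (64 * q) ∩ (sepArmsOnGlueCol κ s true q ∩ sepArmsOnGlueCol κ s false q) ∩
        sepArmsOn κ s (512 * (q + 1)) n₃ ⊆ armEvent κ n₁ n₃ := by
  rintro ω ⟨⟨⟨X, hX, hA⟩, hGT, hGF⟩, ⟨Y, hY, hB⟩⟩
  refine mem_armEvent_of_disjointPaths κ (fun j => glueZone q n₁ n₃ (s j).val (X j) (Y j) ∩ {v | v ∈ ω ↔ κ j})
    (fun i j hij => glueZone_colour_disjoint_on κ s hs hq hX hY ω hij) fun j => ?_
  obtain ⟨x, y, hx, hy, hp⟩ :=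
    sepArmAt_glue_path hq h4 h₁ h₃ (hA j) (readFrame_mem_fourGlue_of_mem_on hGT hGF j) (hB j)
  refine ⟨x, y, hx, hy, hp.mono ?_⟩
  rintro v ⟨⟨hvZ, hvA⟩, hvc⟩
  exact ⟨⟨⟨hvZ, hvc⟩, hvA⟩, hvc⟩

/-- **Extending `k ≤ 6` well-separated arms of any colours** (Nolin 2008, Prop. 12 (i)
[arXiv 0711.4948: Prop. 11], extendability): a well-separated `k`-arm event across
`Λ_{64q} ∖ Λ_{n₁}` together with the extension events in the `k` frames contains
`armEvent κ n₁ (512(q+1) - 1)`. [cite: Nolin2008, §4.3 Prop. 12 (arXiv 0711.4948: Prop. 11)] -/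
theorem sepArmsOn_glueExt_subset (κ : Fin k → Bool) (s : Fin k → Fin 6) (hs : Function.Injective s) {q n₁ : ℕ} (hq : 1 ≤ q) (h4 : 4 ≤ n₁)
    (h₁ : n₁ ≤ 64 * q) :
    sepArmsOn κ s n₁ (64 * q) ∩ (sepArmsOnGlueExtCol κ s true q ∩ sepArmsOnGlueExtCol κ s false q) ⊆
      armEvent κ n₁ (512 * (q + 1) - 1) := by
  rintro ω ⟨⟨X, hX, hA⟩, hGT, hGF⟩
  set n₃ := 512 * (q + 1) with hn₃
  have hE : ∀ i j : Fin k, i ≠ j → κ i = κ j → Disjoint ((fun _ => (∅ : Set (Site 2))) i) ((fun _ => (∅ : Set (Site 2))) j) :=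
    fun _ _ _ _ => disjoint_bot_left
  refine mem_armEvent_of_disjointPaths κ (fun j => glueZone q n₁ n₃ (s j).val (X j) ∅ ∩ {v | v ∈ ω ↔ κ j})
    (fun i j hij => glueZone_colour_disjoint_on κ s hs hq hX hE ω hij) fun j => ?_
  obtain ⟨x, y, hx, hy, hp⟩ :=
    sepArmAt_glueExt_path n₃ hq h4 h₁ (hA j) (readFrame_mem_fourGlueExt_of_mem_on hGT hGF j)
  refine ⟨x, y, hx, hy, hp.mono ?_⟩
  rintro v ⟨⟨hvZ, hvA⟩, hvc⟩
  exact ⟨⟨⟨hvZ, hvc⟩, hvA⟩, hvc⟩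


/-- The event `sepArms κ` of `SepArmsGlue.lean` (arm `j` on side `j`, `k ≤ 6`) is the instance
`s = Fin.castLE hk` of `sepArmsOn`. [folklore] -/
theorem sepArms_eq_sepArmsOn (hk : k ≤ 6) (κ : Fin k → Bool) (n N : ℕ) :
    sepArms κ n N = sepArmsOn κ (Fin.castLE hk) n N := rfl

end Literature.Probability.Percolation

end
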